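import Mathlib.NumberTheory.Zsqrtd.Basic
import Mathlib.FieldTheory.Finite.GaloisField
import Mathlib.NumberTheory.LegendreSymbol.JacobiSymbol
import Mathlib.RingTheory.IntegralDomain
import HarnessLib

set_option linter.dupNamespace false -- `Summit.BirchSwinnertonDyer.BirchSwinnertonDyer.Theorems.…` (summit = sub, D-0017)
set_option autoImplicit false

/-!
# Crux `HeegnerTwistCouplingInSupply` (stmt-BirchSwinnertonDyer-21381) — the SYLVESTER `j = 0` corner, CUBIC BRIDGE:
# the Lucas certificate `p ∤ Im((a + b√M)^{(p+1)/3})` FAILS iff the cubic `X³ − 3X − a` has a root in `𝔽_p`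

Route `BiquadraticEisensteinDescent` (cell `pub/bsd-wall`; width seat `bsd-wall-cm-bed-w4` g31; THEOREMS ONLY, `--supports`
stmt-BirchSwinnertonDyer-21381, helper). The Sylvester-corner files (`…SylvesterCorner*`, w4 g26) certify
`L(W_p^{(d_K)}, 1) ≠ 0` (modulo the `3`-descent hypothesis and Burungale–Tian) from a norm-one unit `u = (a + b√M)/2`
(`M = −3 d_K`, `a² − M b² = 4`) of the real quadratic field `ℚ(√M)` that is NOT a cube modulo the inert prime `p ≡ 2 (mod 3)`,
in the kernel-decidable LUCAS FORM `p ∤ Im((a + b√M)^{(p+1)/3})` (computed in Mathlib's `ℤ√M`). This file proves the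
CUBIC FORM of the same condition, for every odd prime `p ≡ 2 (mod 3)` with `(M/p) = −1` and `a² − M b² = 4`:

  `p ∣ Im((a + b√M)^{(p+1)/3})`  ⟺  `∃ x ∈ 𝔽_p, x³ − 3x − a = 0`   (`dvd_im_iff_exists_root_cubic`).

So the certificate holds exactly at the primes where `X³ − 3X − a` is irreducible mod `p` (for `(d_K/p) = +1` the cubic has `0` or
`3` roots: its discriminant is `−27(a² − 4) = 81 d_K b²`, a square mod `p`). This isolates the class-field-theoretic content of the
corner's unit condition (w4 g30's hypothesis `hCube`: «`9 ∤ t` ⟹ non-cube») as the SPLITTING LAW of one cubic polynomial over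
`K = ℚ(√d_K)` — not proved here, not in Mathlib (Artin reciprocity for the `S₃`-closure `K(θ)`, conductor `9`).

Proof (elementary, in a field `F` with `p²` elements — Mathlib's `GaloisField p 2`): `Θ = √M ∈ F` exists (`M ∈ 𝔽_p^×` is a square in
`𝔽_{p²}`), the Frobenius `x ↦ x^p` maps `Θ ↦ −Θ` (Euler: `M^{(p−1)/2} = −1`), so `z = a + bΘ` has `z^p = z̄`, `z z̄ = 4`, and
`u = z/2` has `u^{p+1} = 1`, `u + u^p = a`. Put `n = (p+1)/3`.
(⟹) `p ∣ Im(z^n)` says `z^n ∈ 𝔽_p`, so `z̄^n = z^n`, `(z^n)² = 4^n`, `u^{2n} = 1 = u^{3n}`, `u^n = 1`; in the cyclic group `F^×` of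
order `p² − 1 = 3n(p − 1)` this gives `u = η³` with `η^{p+1} = 1`; then `θ = η + η⁻¹` is Frobenius-fixed, i.e. `θ ∈ 𝔽_p` (root count
of `X^p − X`), and `θ³ − 3θ = η³ + η⁻³ = u + u⁻¹ = a`.
(⟸) a root `x ∈ 𝔽_p` gives `η = (x + √(x² − 4))/2 ∈ F` with `η η' = 1`, `η + η' = x`, so `η³ + η'³ = x³ − 3x = a`, `η³η'³ = 1`:
`u ∈ {η³, η'³}` (both pairs are the roots of `Y² − aY + 1`), whence `u^n = η^{p+1}` (or `η'^{p+1}`) `= η·φ(η)`-type products…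
precisely `u^n = η^{3n} = η^{p+1}`, which is Frobenius-fixed (`φ² = id`), so `(z^n)^p = z^n`, i.e. `Im(z^n) ≡ 0`.

* §1 two finite-field lemmas: Frobenius-fixed elements of a `ZMod p`-algebra field come from `ZMod p` (root count), and every
  element of `𝔽_p` is a square in a field with `p²` elements.
* §2 ★★ `dvd_im_iff_exists_root_cubic` (in an abstract `F` with `#F = p²`: `dvd_im_iff_exists_root_cubic_of_card`), its two
  directions, and the contrapositive `lucas_of_forall_cubic_ne_zero` consumed by the corner theorems
  (`…SylvesterCornerSqrtMinusTwo`).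

HONEST FRAMING: an elementary reformulation; it proves no case of the splitting law, no descent, nothing about the crux (residual
C⁺) or BSD. No definition, no named fact, no `sorry`; axioms standard.
[cite: IrelandRosen1990, Prop. 5.1.2, Prop. 7.1.2 and §9.1] [cite: CohenPazuki2009, §2]
-/

noncomputable section

open scoped Classical

namespace Summit.BirchSwinnertonDyer.BirchSwinnertonDyer.Theorems.SylvesterCorner

open Polynomial

/-! ## §1 Two finite-field lemmas -/

section FiniteField

/-- `p² / 2 = (p − 1)·((p + 1)/2)` for odd `p`. [folklore] -/
theorem sq_div_two_eq {p : ℕ} (hodd : p % 2 = 1) : p ^ 2 / 2 = (p - 1) * ((p + 1) / 2) := by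
  obtain ⟨j, hj⟩ : ∃ j, p = 2 * j + 1 := ⟨p / 2, by omega⟩
  have h1 : (p + 1) / 2 = j + 1 := by omega
  have h2 : p - 1 = 2 * j := by omega
  have h3 : p ^ 2 = 2 * (2 * j * (j + 1)) + 1 := by rw [hj]; ring
  rw [h1, h2, h3]
  generalize 2 * j * (j + 1) = X at *
  omega

variable {p : ℕ} [hp : Fact p.Prime] {F : Type} [Field F] [Algebra (ZMod p) F]

/-- **Frobenius-fixed elements are rational**: in a field `F` over `𝔽_p`, an element with `x^p = x` lies in (the image of) `𝔽_p` —
the `p` elements of `𝔽_p` already exhaust the roots of `X^p − X`. [cite: IrelandRosen1990, Prop. 7.1.2] -/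
theorem exists_algebraMap_eq_of_pow_eq (x : F) (hx : x ^ p = x) : ∃ c : ZMod p, algebraMap (ZMod p) F c = x := by
  by_contra hne
  push Not at hne
  have hp1 : 1 < p := hp.out.one_lt
  set f : F[X] := X ^ p - X with hf
  have hf0 : f ≠ 0 := FiniteField.X_pow_card_sub_X_ne_zero F hp1
  have hdeg : f.natDegree = p := FiniteField.X_pow_card_sub_X_natDegree_eq F hp1
  -- the `p + 1` distinct roots `algebraMap c` (`c ∈ 𝔽_p`) and `x`
  set S : Finset F := insert x (Finset.univ.image (algebraMap (ZMod p) F)) with hS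
  have hSroots : S ⊆ f.roots.toFinset := by
    intro y hy
    rw [Multiset.mem_toFinset, mem_roots hf0, IsRoot.def, hf, eval_sub, eval_pow, eval_X, sub_eq_zero]
    rcases Finset.mem_insert.mp hy with rfl | hy'
    · exact hx
    · obtain ⟨c, -, rfl⟩ := Finset.mem_image.mp hy'
      rw [← map_pow, ZMod.pow_card]
  have hcardS : S.card = p + 1 := by
    rw [hS, Finset.card_insert_of_notMem, Finset.card_image_of_injective _ (algebraMap (ZMod p) F).injective,
      Finset.card_univ, ZMod.card]
    intro hmem
    obtain ⟨c, -, hc⟩ := Finset.mem_image.mp hmem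
    exact hne c hc
  have h1 : S.card ≤ f.roots.toFinset.card := Finset.card_le_card hSroots
  have h2 : f.roots.toFinset.card ≤ p := (Multiset.toFinset_card_le _).trans (hdeg ▸ card_roots' f)
  omega

/-- **Every element of `𝔽_p` is a square in a field with `p²` elements** (`p` odd): `c^{(p²−1)/2} = (c^{p−1})^{(p+1)/2} = 1`.
[cite: IrelandRosen1990, Prop. 7.1.2 and Prop. 5.1.2] -/
theorem isSquare_algebraMap_of_card_eq_sq [Fintype F] (hcard : Fintype.card F = p ^ 2) (hp2 : p ≠ 2) (c : ZMod p) :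
    IsSquare (algebraMap (ZMod p) F c) := by
  by_cases hc : c = 0
  · exact ⟨0, by simp [hc]⟩
  have hodd : p % 2 = 1 := Nat.odd_iff.mp (hp.out.odd_of_ne_two hp2)
  have hchar : ringChar F ≠ 2 := by
    intro h2
    haveI : CharP F 2 := ringChar.of_eq h2
    have h2F : ((2 : ℕ) : F) = 0 := CharP.cast_eq_zero F 2
    have h2Z : ((2 : ℕ) : ZMod p) ≠ 0 := by
      rw [Ne, ZMod.natCast_eq_zero_iff]
      intro hdvd
      exact hp2 ((Nat.prime_dvd_prime_iff_eq hp.out Nat.prime_two).mp hdvd)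
    apply h2Z
    apply (algebraMap (ZMod p) F).injective
    rw [map_natCast, map_zero, h2F]
  rw [FiniteField.isSquare_iff hchar ((_root_.map_ne_zero _).mpr hc), hcard, sq_div_two_eq hodd, pow_mul, ← map_pow,
    ZMod.pow_card_sub_one_eq_one hc, map_one, one_pow]

end FiniteField

/-! ## §2 The cubic bridge -/

section Core

variable {p : ℕ} [hp : Fact p.Prime] {F : Type} [Field F] [Fintype F] [Algebra (ZMod p) F] [CharP F p]

/-- ★★ **The cubic bridge, in any field `F` with `p²` elements.** For an odd prime `p ≡ 2 (mod 3)`, integers `M, a, b` with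
`(M/p) = −1` and `a² − M b² = 4`: `p ∣ Im((a + b√M)^{(p+1)/3})` (in `ℤ√M`) iff `X³ − 3X − a` has a root in `𝔽_p`.
(`u = (a + b√M)/2 ∈ F` has `u^{p+1} = 1`, `u + u^p = a`; `p ∣ Im` iff `u^{(p+1)/3}` is Frobenius-fixed iff `u^{(p+1)/3} = 1` iff
`u = η³` with `η^{p+1} = 1` (cyclicity of `F^×`), and then `θ = η + η⁻¹ ∈ 𝔽_p` is a root; conversely a root `x` gives `η = (x + √(x²−4))/2`,
`u ∈ {η³, η'³}`, `u^{(p+1)/3} = η^{p+1}` Frobenius-fixed.) [cite: IrelandRosen1990, Prop. 5.1.2, Prop. 7.1.2 and §9.1] -/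
theorem dvd_im_iff_exists_root_cubic_of_card (hcard : Fintype.card F = p ^ 2) (hp2 : p ≠ 2) (hp3 : p % 3 = 2)
    {M a b : ℤ} (hJ : jacobiSym M p = -1) (hab : a ^ 2 - M * b ^ 2 = 4) :
    (p : ℤ) ∣ ((⟨a, b⟩ : ℤ√M) ^ ((p + 1) / 3)).im ↔ ∃ x : ZMod p, x ^ 3 - 3 * x - (a : ZMod p) = 0 := by
  have hpp := hp.out
  haveI : ExpChar F p := ExpChar.prime hpp
  have hodd : p % 2 = 1 := Nat.odd_iff.mp (hpp.odd_of_ne_two hp2)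
  -- integer casts factor through `𝔽_p` and are Frobenius-fixed
  have hιz : ∀ z : ℤ, algebraMap (ZMod p) F (z : ZMod p) = (z : F) := fun z => map_intCast _ z
  have hFrobInt : ∀ z : ℤ, ((z : F)) ^ p = (z : F) := fun z => by
    rw [← hιz, ← map_pow, ZMod.pow_card]
  have hFrobι : ∀ c : ZMod p, (algebraMap (ZMod p) F c) ^ p = algebraMap (ZMod p) F c := fun c => by
    rw [← map_pow, ZMod.pow_card]
  have hFrob2 : ∀ y : F, (y ^ p) ^ p = y := fun y => by rw [← pow_mul, ← sq, ← hcard, FiniteField.pow_card]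
  -- `p ∤ M`; `(M : F) ≠ 0`; `(2 : F) ≠ 0`
  have hpM : ¬ (p : ℤ) ∣ M := by
    intro hdvd
    have h0 : jacobiSym M p = 0 := by
      rw [jacobiSym.mod_left, Int.emod_eq_zero_of_dvd hdvd, jacobiSym.zero_left hpp.one_lt]
    rw [h0] at hJ; norm_num at hJ
  have hMF : (M : F) ≠ 0 := by rwa [Ne, CharP.intCast_eq_zero_iff F p]
  have h2F : (2 : F) ≠ 0 := by
    intro h
    have : ((2 : ℕ) : F) = 0 := by exact_mod_cast h
    rw [CharP.cast_eq_zero_iff F p] at this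
    exact hp2 ((Nat.prime_dvd_prime_iff_eq hpp Nat.prime_two).mp this)
  have h2p : (2 : F) ^ p = 2 := by exact_mod_cast hFrobInt 2
  -- `Θ = √M ∈ F`, `Θ^p = −Θ` (Euler)
  obtain ⟨Θ, hΘ⟩ := isSquare_algebraMap_of_card_eq_sq hcard hp2 (M : ZMod p)
  have hΘΘ : Θ * Θ = (M : F) := by rw [← hιz, hΘ]
  have hΘ0 : Θ ≠ 0 := fun h => hMF (by rw [← hΘΘ, h, mul_zero])
  have hEul : (M : F) ^ (p / 2) = -1 := by
    have hleg : legendreSym p M = -1 := by rw [jacobiSym.legendreSym.to_jacobiSym]; exact hJ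
    have hz : (M : ZMod p) ^ (p / 2) = -1 := by
      have := legendreSym.eq_pow p M
      rw [hleg] at this
      push_cast at this
      exact this.symm
    have := congrArg (algebraMap (ZMod p) F) hz
    rwa [map_pow, hιz, map_neg, map_one] at this
  have hFrobΘ : Θ ^ p = -Θ := by
    have hp' : p = 2 * (p / 2) + 1 := by omega
    conv_lhs => rw [hp']
    rw [pow_succ, pow_mul, sq, hΘΘ, hEul]; ring
  -- `z = a + bΘ`, `z̄ = a − bΘ = z^p`, `z z̄ = 4`
  set z : F := (a : F) + (b : F) * Θ with hz_def
  set zb : F := (a : F) - (b : F) * Θ with hzb_def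
  have hFrobz : z ^ p = zb := by
    rw [hz_def, add_pow_expChar, mul_pow, hFrobInt, hFrobInt, hFrobΘ, hzb_def]; ring
  have hzzb : z * zb = 4 := by
    have h4 : ((a : F)) ^ 2 - (M : F) * (b : F) ^ 2 = 4 := by exact_mod_cast congrArg (Int.cast : ℤ → F) hab
    rw [hz_def, hzb_def]
    linear_combination h4 - ((b : F)) ^ 2 * hΘΘ
  -- `n = (p+1)/3`; `u = z/2`: `u^p = z̄/2`, `u·u^p = 1`, `u + u^p = a`
  set n : ℕ := (p + 1) / 3 with hn
  have h3n : 3 * n = p + 1 := by omega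
  have hn0 : n ≠ 0 := by omega
  set u : F := z / 2 with hu_def
  have hz2u : z = 2 * u := by rw [hu_def]; field_simp
  have hFrobu : u ^ p = zb / 2 := by rw [hu_def, div_pow, hFrobz, h2p]
  have huu : u * u ^ p = 1 := by
    rw [hFrobu, hu_def]
    field_simp
    linear_combination hzzb
  have hu0 : u ≠ 0 := fun h => by rw [h, zero_mul] at huu; exact zero_ne_one huu
  have hup1 : u ^ (p + 1) = 1 := by rw [pow_succ', huu]
  have hsum : u + u ^ p = (a : F) := by
    rw [hFrobu, hu_def, hz_def, hzb_def]
    field_simp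
    ring
  -- the `ℤ√M` side: `W = (a + b√M)^n ↦ z^n`
  set φZ : ℤ√M →+* F := Zsqrtd.lift ⟨Θ, hΘΘ⟩ with hφZ
  have hφab : φZ ⟨a, b⟩ = z := by simp [hφZ, hz_def]
  set W : ℤ√M := (⟨a, b⟩ : ℤ√M) ^ n with hW
  have hWz : (W.re : F) + (W.im : F) * Θ = z ^ n := by
    have : φZ W = (W.re : F) + (W.im : F) * Θ := by simp [hφZ]
    rw [← this, hW, map_pow, hφab]
  -- KEY 1: `p ∣ Im(W)` iff `z^n` is Frobenius-fixed
  have key1 : (p : ℤ) ∣ W.im ↔ (z ^ n) ^ p = z ^ n := by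
    constructor
    · intro hdvd
      have him : (W.im : F) = 0 := (CharP.intCast_eq_zero_iff F p _).mpr hdvd
      rw [← hWz, him, zero_mul, add_zero, hFrobInt]
    · intro hfix
      rw [← hWz, add_pow_expChar, mul_pow, hFrobInt, hFrobInt, hFrobΘ] at hfix
      have hY : ((W.im : F)) * (2 * Θ) = 0 := by linear_combination -hfix
      rcases mul_eq_zero.mp hY with hY0 | h20
      · exact (CharP.intCast_eq_zero_iff F p _).mp hY0
      · exact absurd (mul_eq_zero.mp h20) (not_or.mpr ⟨h2F, hΘ0⟩)
  -- KEY 2: `z^n` Frobenius-fixed iff `u^n` is (`z = 2u`, `2 ∈ 𝔽_p`)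
  have h2np : ((2 : F) ^ n) ^ p = 2 ^ n := by rw [← pow_mul, mul_comm, pow_mul, h2p]
  have key2 : (z ^ n) ^ p = z ^ n ↔ (u ^ n) ^ p = u ^ n := by
    rw [hz2u, mul_pow, mul_pow, h2np]
    exact mul_right_inj' (pow_ne_zero _ h2F)
  rw [key1, key2]
  constructor
  · -- (⟹): `u^n = 1`, `u = η³` with `η^{p+1} = 1`, `θ = η + η⁻¹ ∈ 𝔽_p` is a root
    intro hfix
    have hun2 : (u ^ n) ^ 2 = 1 := by
      have h : u ^ n * (u ^ n) ^ p = 1 := by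
        rw [← pow_mul, mul_comm n p, pow_mul, ← mul_pow, huu, one_pow]
      rw [hfix] at h
      rw [sq]; exact h
    have hun3 : (u ^ n) ^ 3 = 1 := by rw [← pow_mul, mul_comm, h3n, hup1]
    have hun : u ^ n = 1 := by
      have h : (u ^ n) ^ 3 = (u ^ n) ^ 2 * u ^ n := by ring
      rw [hun3, hun2, one_mul] at h
      exact h.symm
    -- cyclicity of `F^×`
    set U : Fˣ := Units.mk0 u hu0 with hU
    obtain ⟨g, hg⟩ := IsCyclic.exists_generator (α := Fˣ)
    have hord : orderOf g = p ^ 2 - 1 := by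
      rw [orderOf_eq_card_of_forall_mem_zpowers hg, Nat.card_units, Nat.card_eq_fintype_card, hcard]
    obtain ⟨k, hk⟩ := Subgroup.mem_zpowers_iff.mp (hg U)
    have hUn : U ^ n = 1 := by
      ext
      rw [Units.val_pow_eq_pow_val, hU, Units.val_mk0, hun, Units.val_one]
    have h1p : 1 ≤ p := hpp.one_lt.le
    have h1p2 : 1 ≤ p ^ 2 := Nat.one_le_pow 2 p hpp.pos
    have hfac : ((p ^ 2 - 1 : ℕ) : ℤ) = (n : ℤ) * (3 * ((p - 1 : ℕ) : ℤ)) := by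
      have h3n' : (3 : ℤ) * n = p + 1 := by exact_mod_cast h3n
      push_cast [Nat.cast_sub h1p, Nat.cast_sub h1p2]
      linear_combination (1 - (p : ℤ)) * h3n'
    have hpm : ((p - 1 : ℕ) : ℤ) * ((p + 1 : ℕ) : ℤ) = ((p ^ 2 - 1 : ℕ) : ℤ) := by
      push_cast [Nat.cast_sub h1p, Nat.cast_sub h1p2]
      ring
    have hdvd : ((p ^ 2 - 1 : ℕ) : ℤ) ∣ k * n := by
      rw [← hord, orderOf_dvd_iff_zpow_eq_one, zpow_mul, hk, zpow_natCast, hUn]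
    rw [hfac, mul_comm k] at hdvd
    obtain ⟨j, hj⟩ := (mul_dvd_mul_iff_left (by exact_mod_cast hn0 : (n : ℤ) ≠ 0)).mp hdvd
    set η : Fˣ := g ^ (((p - 1 : ℕ) : ℤ) * j) with hη
    have hη3 : η ^ 3 = U := by
      rw [← hk, hj, hη, ← zpow_natCast, ← zpow_mul]
      congr 1
      push_cast
      ring
    have hηp1 : η ^ (p + 1) = 1 := by
      rw [hη, ← zpow_natCast, ← zpow_mul]
      have hexp : (((p - 1 : ℕ) : ℤ) * j) * ((p + 1 : ℕ) : ℤ) = ((p ^ 2 - 1 : ℕ) : ℤ) * j := by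
        rw [← hpm]; ring
      rw [hexp, zpow_mul, zpow_natCast, ← hord, pow_orderOf_eq_one, one_zpow]
    -- `θ = η + η⁻¹`
    have hηF0 : (η : F) ≠ 0 := η.ne_zero
    have hηpF : (η : F) ^ p = ((η : F))⁻¹ := by
      have h1 : (η : F) ^ (p + 1) = 1 := by rw [← Units.val_pow_eq_pow_val, hηp1, Units.val_one]
      rw [pow_succ] at h1
      exact eq_inv_of_mul_eq_one_left h1
    set θ : F := (η : F) + ((η : F))⁻¹ with hθ
    have hθp : θ ^ p = θ := by
      rw [hθ, add_pow_expChar, inv_pow, hηpF, inv_inv, add_comm]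
    have he3 : (η : F) ^ 3 = u := by rw [← Units.val_pow_eq_pow_val, hη3, hU, Units.val_mk0]
    have hupinv : u ^ p = u⁻¹ := eq_inv_of_mul_eq_one_right huu
    have hee : (η : F) * ((η : F))⁻¹ = 1 := mul_inv_cancel₀ hηF0
    have hθ3 : θ ^ 3 - 3 * θ - (a : F) = 0 := by
      calc θ ^ 3 - 3 * θ - (a : F)
          = (η : F) ^ 3 + (((η : F))⁻¹) ^ 3 + 3 * ((η : F) * ((η : F))⁻¹) * θ - 3 * θ - (a : F) := by
            rw [hθ]; ring
        _ = u + u⁻¹ - (a : F) := by rw [hee, inv_pow, he3]; ring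
        _ = 0 := by rw [← hupinv, hsum, sub_self]
    obtain ⟨x, hx⟩ := exists_algebraMap_eq_of_pow_eq θ hθp
    refine ⟨x, ?_⟩
    have himg : algebraMap (ZMod p) F (x ^ 3 - 3 * x - (a : ZMod p)) = 0 := by
      rw [map_sub, map_sub, map_pow, map_mul, map_ofNat, hιz, hx]
      exact hθ3
    exact (map_eq_zero_iff _ (algebraMap (ZMod p) F).injective).mp himg
  · -- (⟸): a root `x` gives `η = (x + √(x² − 4))/2`, `u ∈ {η³, η'³}`, `u^n = η^{p+1}` Frobenius-fixed
    rintro ⟨x, hx⟩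
    set ξ : F := algebraMap (ZMod p) F x with hξ
    have hξ3 : ξ ^ 3 - 3 * ξ - (a : F) = 0 := by
      have h := congrArg (algebraMap (ZMod p) F) hx
      rwa [map_sub, map_sub, map_pow, map_mul, map_ofNat, hιz, map_zero] at h
    obtain ⟨s, hs⟩ := isSquare_algebraMap_of_card_eq_sq hcard hp2 (x ^ 2 - 4)
    have hss : s * s = ξ ^ 2 - 4 := by rw [← hs, map_sub, map_pow, map_ofNat]
    set η : F := (ξ + s) / 2 with hη
    set η' : F := (ξ - s) / 2 with hη'
    have hηη' : η * η' = 1 := by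
      rw [hη, hη']
      field_simp
      linear_combination -hss
    have hsum' : η + η' = ξ := by
      rw [hη, hη']
      field_simp
      ring
    have hcubes : η ^ 3 + η' ^ 3 = (a : F) := by
      have h : η ^ 3 + η' ^ 3 = (η + η') ^ 3 - 3 * (η * η') * (η + η') := by ring
      rw [h, hηη', hsum']
      linear_combination hξ3
    have hprod : (u - η ^ 3) * (u - η' ^ 3) = 0 := by
      have h1 : η ^ 3 * η' ^ 3 = 1 := by rw [← mul_pow, hηη', one_pow]
      have h2 : u ^ 2 - (a : F) * u + 1 = 0 := by
        rw [← hsum]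
        linear_combination -huu
      calc (u - η ^ 3) * (u - η' ^ 3) = u ^ 2 - (η ^ 3 + η' ^ 3) * u + η ^ 3 * η' ^ 3 := by ring
        _ = 0 := by rw [hcubes, h1]; exact h2
    have hfixN : ∀ ρ : F, (ρ ^ (p + 1)) ^ p = ρ ^ (p + 1) := fun ρ => by
      rw [pow_succ, mul_pow, hFrob2, mul_comm]
    rcases mul_eq_zero.mp hprod with h | h
    · rw [sub_eq_zero.mp h, ← pow_mul η 3 n, h3n]
      exact hfixN η
    · rw [sub_eq_zero.mp h, ← pow_mul η' 3 n, h3n]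
      exact hfixN η'

end Core

section Bridge

/-- ★★ **THE CUBIC BRIDGE.** For an odd prime `p ≡ 2 (mod 3)` and integers `M, a, b` with `(M/p) = −1`, `a² − M b² = 4`:
`p ∣ Im((a + b√M)^{(p+1)/3})` (the Lucas certificate of the Sylvester corner FAILS) iff the cubic `X³ − 3X − a` has a root in `𝔽_p`.
[cite: IrelandRosen1990, Prop. 5.1.2, Prop. 7.1.2 and §9.1] [cite: CohenPazuki2009, §2] -/
theorem dvd_im_iff_exists_root_cubic {p : ℕ} (hp : p.Prime) (hp2 : p ≠ 2) (hp3 : p % 3 = 2) {M a b : ℤ}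
    (hJ : jacobiSym M p = -1) (hab : a ^ 2 - M * b ^ 2 = 4) :
    (p : ℤ) ∣ ((⟨a, b⟩ : ℤ√M) ^ ((p + 1) / 3)).im ↔ ∃ x : ZMod p, x ^ 3 - 3 * x - (a : ZMod p) = 0 := by
  haveI : Fact p.Prime := ⟨hp⟩
  haveI : Fintype (GaloisField p 2) := Fintype.ofFinite _
  have hcard : Fintype.card (GaloisField p 2) = p ^ 2 := by
    rw [← Nat.card_eq_fintype_card]; exact GaloisField.card p 2 two_ne_zero
  exact dvd_im_iff_exists_root_cubic_of_card (F := GaloisField p 2) hcard hp2 hp3 hJ hab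

/-- ★ One direction: if the Lucas certificate fails, `X³ − 3X − a` has a root mod `p`. [cite: IrelandRosen1990, §9.1] -/
theorem exists_root_cubic_of_dvd_im {p : ℕ} (hp : p.Prime) (hp2 : p ≠ 2) (hp3 : p % 3 = 2) {M a b : ℤ}
    (hJ : jacobiSym M p = -1) (hab : a ^ 2 - M * b ^ 2 = 4)
    (h : (p : ℤ) ∣ ((⟨a, b⟩ : ℤ√M) ^ ((p + 1) / 3)).im) :
    ∃ x : ZMod p, x ^ 3 - 3 * x - (a : ZMod p) = 0 :=
  (dvd_im_iff_exists_root_cubic hp hp2 hp3 hJ hab).mp h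

/-- ★ The other direction: a root of `X³ − 3X − a` mod `p` kills the Lucas certificate. [cite: IrelandRosen1990, §9.1] -/
theorem dvd_im_of_root_cubic {p : ℕ} (hp : p.Prime) (hp2 : p ≠ 2) (hp3 : p % 3 = 2) {M a b : ℤ}
    (hJ : jacobiSym M p = -1) (hab : a ^ 2 - M * b ^ 2 = 4) {x : ZMod p} (hx : x ^ 3 - 3 * x - (a : ZMod p) = 0) :
    (p : ℤ) ∣ ((⟨a, b⟩ : ℤ√M) ^ ((p + 1) / 3)).im :=
  (dvd_im_iff_exists_root_cubic hp hp2 hp3 hJ hab).mpr ⟨x, hx⟩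

/-- ★★ **The certificate from irreducibility**: if `X³ − 3X − a` has NO root in `𝔽_p` then `p ∤ Im((a + b√M)^{(p+1)/3})` — the Lucas
certificate consumed by `SylvesterCorner.cruxConclusion_of_certificate`. [cite: IrelandRosen1990, §9.1] [cite: CohenPazuki2009, §2] -/
theorem lucas_of_forall_cubic_ne_zero {p : ℕ} (hp : p.Prime) (hp2 : p ≠ 2) (hp3 : p % 3 = 2) {M a b : ℤ}
    (hJ : jacobiSym M p = -1) (hab : a ^ 2 - M * b ^ 2 = 4) (h : ∀ x : ZMod p, x ^ 3 - 3 * x - (a : ZMod p) ≠ 0) :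
    ¬ (p : ℤ) ∣ ((⟨a, b⟩ : ℤ√M) ^ ((p + 1) / 3)).im := fun hd => by
  obtain ⟨x, hx⟩ := exists_root_cubic_of_dvd_im hp hp2 hp3 hJ hab hd
  exact h x hx

end Bridge

end Summit.BirchSwinnertonDyer.BirchSwinnertonDyer.Theorems.SylvesterCorner
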